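import Literature.NumberTheory.LFunctions.TruncatedWeilFormTailDensityRepr
import HarnessLib

/-!
# RH-FREE — «nothing here bears on the truth of RH»: the archimedean tail increment of the truncated Weil form is a Cauchy–Stieltjes integral of rank-two densities — DISCHARGE of Groskin 2026 Lemma 2.1 (limit clause) and Corollary 3.3 (i)

LINE 1 — LABEL: RH-FREE (finite calculus identities and a Loewner-order statement for the
Connes–van Suijlekom / Connes–Consani–Moscovici divided-difference matrices at FIXED `(c, N)`).
FRAMING (cells `rh-columns/lit` + `rh-crit`, D-0074): corpus theorems are RH-FREE literature;
nothing here is worded as progress toward RH. bears_on: W-C/W-P (LADDER-RH COLUMN 2, Weil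
positivity: "a semilocal object whose positivity is a theorem of its construction" — here the
archimedean TAIL `Q_∞ − Q_T^tot`, whose positivity IS a theorem of its construction). WHAT THIS IS
NOT: any statement about `ζ`, about the sign of `Q_∞` or `Q_T^tot` themselves, or about RH; "the
paper does not prove RH, Weil positivity, a prime-location bound" ([Gr26] p. 13) and neither does a
kernel replay of its §3. The source is an UNREFEREED preprint (D-0012): a kernel proof VERIFIES the
identities it prints; it asserts nothing on authority. Nothing here bears on the truth of RH.

Source: A. Groskin, *A finite Guinand–Weil dictionary and archimedean tail order for the truncated
Weil quadratic form*, arXiv:2607.02828v3 [Groskin2026], §3 (pp. 8–11); statements typed in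
`TruncatedWeilFormTailOrder.lean` (p461241). THEOREM-ONLY module: no definition, no named fact.

## What is PROVED

* `Groskin2026.lemma_2_1_limit_holds : lemma_2_1_limit` — **Lemma 2.1, first clause**: the limit
  `Q_arch,∞ = lim_{T→∞} Q_arch,T` exists entrywise (so the typed `archMatrixInfty` IS that limit).
* `Groskin2026.corollary_3_3_i_holds : corollary_3_3_i` — **Corollary 3.3 (i)** in the typed Loewner
  form: for `T > max(ρN, 7)`, `Q_∞ − Q_T^tot ≻ 0` and `Q_∞ − Q_T^tot ⪯ B_T·I` (the hypothesis of the
  in-file decision rules `corollary_3_3_certify_pos/neg`).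
* On the way (namespace `Groskin2026.ArchTail`): the tail formula
  `ArchTail.archMatrixInfty_sub_apply : (Q_arch,∞ − Q_arch,T)(m,n) =
  (1/π²)∫_T^∞ h₊ sin²(Lr/2) ρ⁻¹ (p_r(m)p_r(n) + q_r(m)q_r(n)) dr` (`T > max(ρN,7)`), the quadratic form
  `ArchTail.quadForm_eq_integral : xᵗ(Q_∞ − Q_T)x = (1/π²)∫_T^∞ h₊ sin² ρ⁻¹ ((x·p_r)² + (x·q_r)²)`, the
  integrability of the rank-two density on `(T, ∞)` (`ArchTail.integrableOn_density`, from the growth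
  bound `h₊(r) ≤ h₊(0) + B√|r|`, `ArchTail.exists_abs_hPlus_le`).  INPUT BY NAME (not re-proved):
  Theorem 3.2 clause 1, `Groskin2026.archMatrix_sub_apply_eq` (`TruncatedWeilFormTailDensityRepr.lean`,
  rh-crit-cc-t18), and the elementary `rho_pos`/`pVec_eq`/`qVec_eq`/`continuous_hPlus`
  (`TruncatedWeilFormTailMinorsProofs.lean`).  NOT proved here: Lemma 2.1's second clause, Lemma 2.2,
  Theorem 2.5, Corollary 3.3 (iii).

## The printed proof (§3, pp. 8–11) and how it is followed

"The tail past `T` is `(1/π²)∫_T^∞ h₊ sin²(Lr/2) ρ⁻¹ (p p + q q)`, convergent since `h₊(r) = O(log r)`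
and `p_r, q_r = O(1/r)`" — §1–§2 here: we use the cruder `h₊(r) ≤ h₊(0) + B√|r|` (termwise AM–GM on
the tree's vertical series `Re ψ(¼ + it/2) = ψ(¼) + Σ_m 2t²/(l_m(l_m² + t²))`,
`DigammaVerticalSeries.lean`), which suffices for an `O(r^{−3/2})` majorant on `(T, ∞)`; with clause 1
of Theorem 3.2 (imported), `intervalIntegral_tendsto_integral_Ioi` gives the limit (Lemma 2.1, first
clause) and `Q_∞ − Q_T = (1/π²)∫_T^∞` entrywise.  "`Q_∞ − Q_T^tot ≻ 0`: `xᵗ(Q_∞ − Q_T^tot)x =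
(1/π²)∫_T^∞ h₊ sin² ρ⁻¹((x·p)² + (x·q)²)` with `h₊ > 0` past `7` and `x·p_r ≢ 0` for `x ≠ 0` (distinct
poles)" — §3: the partial-fraction numerator `P_x(a) = Σ_k x_k Π_{j≠k}(a − j)` is a non-zero polynomial
(evaluate at a node), so `x·p_r = 0` only for `r/ρ` in a finite set; with the finitely many zeros of
`sin(Lr/2)` in `(T, T+1)` removed, a point of strict positivity and continuity of the integrand exists,
and the integral over `(T, ∞)` is positive (`setIntegral_pos_iff_support_of_nonneg_ae`).  "`⪯ B_T I`
since `B_T` is the trace: Cauchy–Schwarz" — `rankTwo_le` + `integral_mono_ae`.  DEVIATION from print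
(said once): the growth input for `h₊` is `O(√r)` from the series, not the sharper Lemma 3.1 bound
`h₊ ≤ log t − 8/5` (a separate claim of the statement file, proved elsewhere in the tree, not needed).
-/

noncomputable section

open Filter Set MeasureTheory Finset Matrix intervalIntegral
open scoped Real Topology

namespace Literature.NumberTheory.LFunctions

namespace Groskin2026

open Literature.Analysis.SpecialFunctions

namespace ArchTail

/-! ## §0 Nodes: `|k| ≤ N` and `r ± ρk ≠ 0` past `ρN` -/

section Nodes

variable {c : ℝ}

/-- An index `k ∈ I_N` has `|k| ≤ N` (as reals). [cite: Groskin2026, §2.1 (p. 3)] -/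
theorem abs_cast_le (N : ℕ) (k : idx N) : |((k : ℤ) : ℝ)| ≤ N := by
  have hkZ : |(k : ℤ)| ≤ (N : ℤ) := by
    rw [Int.abs_eq_natAbs]; exact_mod_cast natAbs_le_of_mem_idx k.2
  exact_mod_cast hkZ

/-- No node `±ρk`, `k ∈ I_N`, lies at or beyond `T₁ > ρN`. [cite: Groskin2026, §3 (p. 8)] -/
theorem node_ne (hc : 1 < c) (N : ℕ) {T₁ : ℝ} (hT₁ : rho c * N < T₁) (k : idx N) {r : ℝ}
    (hr : T₁ ≤ r) : r - rho c * ((k : ℤ) : ℝ) ≠ 0 ∧ r + rho c * ((k : ℤ) : ℝ) ≠ 0 := by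
  have hρ := rho_pos hc
  have hk := abs_le.1 (abs_cast_le N k)
  have h1 : rho c * ((k : ℤ) : ℝ) ≤ rho c * N := mul_le_mul_of_nonneg_left hk.2 hρ.le
  have h2 : rho c * (-(N : ℝ)) ≤ rho c * ((k : ℤ) : ℝ) := mul_le_mul_of_nonneg_left hk.1 hρ.le
  constructor
  · exact (by linarith : 0 < r - rho c * ((k : ℤ) : ℝ)).ne'
  · exact (by linarith : 0 < r + rho c * ((k : ℤ) : ℝ)).ne'

end Nodes

/-! ## §1 Growth of `h₊`, integrability of the rank-two density on `(T, ∞)` -/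

section Limit

variable {c : ℝ}

/-- Termwise bound `f_l(t) = 2t²/(l(l² + t²)) ≤ 2√|t|/(l√l)` (weighted AM–GM). [folklore] -/
private theorem digammaTerm_le_sqrt {l : ℝ} (hl : 0 < l) (t : ℝ) :
    digammaTerm l t ≤ 2 * Real.sqrt |t| / (l * Real.sqrt l) := by
  unfold digammaTerm
  have hu : 0 < Real.sqrt l := Real.sqrt_pos.2 hl
  have hs : 0 ≤ Real.sqrt |t| := Real.sqrt_nonneg _
  have hu2 : Real.sqrt l ^ 2 = l := Real.sq_sqrt hl.le
  have hs2 : Real.sqrt |t| ^ 2 = |t| := Real.sq_sqrt (abs_nonneg t)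
  have ht2 : t ^ 2 = Real.sqrt |t| ^ 4 := by
    rw [show (4:ℕ) = 2 * 2 from rfl, pow_mul, hs2, sq_abs]
  rw [div_le_div_iff₀ (by positivity) (by positivity), ht2]
  set s := Real.sqrt |t| with hsdef
  set u := Real.sqrt l with hudef
  rw [← hu2]
  have key : s ^ 3 * u ≤ u ^ 4 + s ^ 4 := by
    rcases le_total s u with h | h
    · have : s ^ 3 * u ≤ u ^ 3 * u := by gcongr
      nlinarith [pow_nonneg hs 4]
    · have : s ^ 3 * u ≤ s ^ 3 * s :=
        mul_le_mul_of_nonneg_left h (pow_nonneg hs 3)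
      nlinarith [pow_nonneg hu.le 4]
  have h2 : (0:ℝ) ≤ 2 * s * (u ^ 2) := by positivity
  nlinarith [mul_nonneg h2 (sub_nonneg.2 key)]

/-- `Σ_m (l_m√l_m)⁻¹ < ∞` (comparison with the `p = 3/2` series). [folklore] -/
private theorem summable_inv_node_three_halves :
    Summable fun m : ℕ ↦ (digammaNode m * Real.sqrt (digammaNode m))⁻¹ := by
  have hp : Summable fun m : ℕ ↦ (((m : ℝ) + 1) ^ (3 / 2 : ℝ))⁻¹ := by
    have := (summable_nat_add_iff 1).2 (Real.summable_nat_rpow_inv.2 (by norm_num : (1:ℝ) < 3 / 2))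
    refine this.congr fun m ↦ ?_
    push_cast; ring_nf
  have hp' : Summable fun m : ℕ ↦ 4 * (((m : ℝ) + 1) ^ (3 / 2 : ℝ))⁻¹ := hp.mul_left 4
  refine Summable.of_nonneg_of_le (fun m ↦ ?_) (fun m ↦ ?_) hp'
  · have := digammaNode_pos m; positivity
  · have hm1 : (0:ℝ) < (m : ℝ) + 1 := by positivity
    have hl : ((m : ℝ) + 1) / 2 ≤ digammaNode m := by unfold digammaNode; linarith
    have hlpos := digammaNode_pos m
    -- (m+1)^{3/2} = (m+1) √(m+1)
    have e : ((m : ℝ) + 1) ^ (3 / 2 : ℝ) = ((m : ℝ) + 1) * Real.sqrt ((m : ℝ) + 1) := by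
      rw [show (3 / 2 : ℝ) = 1 + 1 / 2 by norm_num, Real.rpow_add hm1, Real.rpow_one,
        Real.sqrt_eq_rpow]
    rw [e]
    -- √((m+1)) ≤ 2 √(l_m)  since (m+1) ≤ 2 l_m ≤ 4 l_m
    have hsq : Real.sqrt ((m : ℝ) + 1) ≤ 2 * Real.sqrt (digammaNode m) := by
      rw [show (2 : ℝ) * Real.sqrt (digammaNode m) = Real.sqrt (4 * digammaNode m) by
        rw [Real.sqrt_mul (by norm_num), show Real.sqrt 4 = 2 by
          rw [show (4:ℝ) = 2 ^ 2 by norm_num, Real.sqrt_sq (by norm_num)]]]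
      exact Real.sqrt_le_sqrt (by linarith)
    have hspos : 0 < Real.sqrt ((m : ℝ) + 1) := Real.sqrt_pos.2 hm1
    rw [show 4 * (((m : ℝ) + 1) * Real.sqrt ((m : ℝ) + 1))⁻¹ =
      (((m : ℝ) + 1) / 2 * (Real.sqrt ((m : ℝ) + 1) / 2))⁻¹ by
        rw [← one_div, ← one_div]; field_simp; ring]
    rw [inv_le_inv₀ (by positivity) (by positivity)]
    exact mul_le_mul hl (by linarith) (by positivity) hlpos.le

/-- **Growth of the archimedean density**: `Re ψ(¼ + it/2) ≤ ψ(¼)… + B√|t|`, precisely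
`∃ B ≥ 0, ∀ t, reDigammaQuarter t ≤ reDigammaQuarter 0 + B √|t|`. [folklore] -/
private theorem exists_reDigammaQuarter_le_sqrt :
    ∃ B : ℝ, 0 ≤ B ∧ ∀ t : ℝ, reDigammaQuarter t ≤ reDigammaQuarter 0 + B * Real.sqrt |t| := by
  set K := ∑' m : ℕ, (digammaNode m * Real.sqrt (digammaNode m))⁻¹ with hK
  have hK0 : 0 ≤ K := tsum_nonneg fun m ↦ by have := digammaNode_pos m; positivity
  refine ⟨2 * K, by positivity, fun t ↦ ?_⟩
  have h1 := hasSum_digammaTerm t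
  have h2 : HasSum (fun m : ℕ ↦ 2 * Real.sqrt |t| * (digammaNode m * Real.sqrt (digammaNode m))⁻¹)
      (2 * Real.sqrt |t| * K) := summable_inv_node_three_halves.hasSum.mul_left _
  have h3 := hasSum_le (fun m ↦ ?_) h1 h2
  · linarith
  · rw [← div_eq_mul_inv]
    exact digammaTerm_le_sqrt (digammaNode_pos m) t

/-- `|h₊(r)| ≤ |h₊(0)| + B√|r|`. [cite: Groskin2026, Lemma 3.1 (p. 9)] -/
theorem exists_abs_hPlus_le : ∃ B : ℝ, 0 ≤ B ∧ ∀ r : ℝ, |hPlus r| ≤ |hPlus 0| + B * Real.sqrt |r| := by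
  obtain ⟨B, hB, h⟩ := exists_reDigammaQuarter_le_sqrt
  refine ⟨B, hB, fun r ↦ ?_⟩
  have h1 := h r
  have h2 := reDigammaQuarter_zero_le r
  have e : ∀ u, hPlus u = reDigammaQuarter u - Real.log π := fun u ↦ rfl
  rw [e, e, abs_le]
  constructor
  · nlinarith [neg_abs_le (reDigammaQuarter 0 - Real.log π), hB, Real.sqrt_nonneg |r|]
  · nlinarith [le_abs_self (reDigammaQuarter 0 - Real.log π)]

/-- `p_r(k)` is continuous at every `r > ρN`. [cite: Groskin2026, §3 (p. 8)] -/
theorem continuousAt_pVec (hc : 1 < c) (N : ℕ) (k : idx N) {T₁ r : ℝ} (hT₁ : rho c * N < T₁)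
    (hr : T₁ ≤ r) : ContinuousAt (fun r ↦ pVec c N r k) r := by
  have hρ := (rho_pos hc).ne'
  have h := (node_ne hc N hT₁ k hr).1
  have h' : r / rho c - ((k : ℤ) : ℝ) ≠ 0 := by
    rw [show r / rho c - ((k : ℤ) : ℝ) = (r - rho c * ((k : ℤ) : ℝ)) / rho c by field_simp]
    exact div_ne_zero h hρ
  unfold pVec aCut
  exact continuousAt_const.div (by fun_prop) h'

/-- `q_r(k)` is continuous at every `r > ρN`. [cite: Groskin2026, §3 (p. 8)] -/
theorem continuousAt_qVec (hc : 1 < c) (N : ℕ) (k : idx N) {T₁ r : ℝ} (hT₁ : rho c * N < T₁)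
    (hr : T₁ ≤ r) : ContinuousAt (fun r ↦ qVec c N r k) r := by
  have hρ := (rho_pos hc).ne'
  have h := (node_ne hc N hT₁ k hr).2
  have h' : r / rho c + ((k : ℤ) : ℝ) ≠ 0 := by
    rw [show r / rho c + ((k : ℤ) : ℝ) = (r + rho c * ((k : ℤ) : ℝ)) / rho c by field_simp]
    exact div_ne_zero h hρ
  unfold qVec aCut
  exact continuousAt_const.div (by fun_prop) h'

/-- `|p_r(k)| ≤ ρ/(r − ρN)` for `r > ρN`. [cite: Groskin2026, §3 (p. 8)] -/
theorem abs_pVec_le (hc : 1 < c) (N : ℕ) (k : idx N) {r : ℝ} (hr : rho c * N < r) :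
    |pVec c N r k| ≤ rho c / (r - rho c * N) := by
  have hρ := rho_pos hc
  have hk := abs_le.1 (abs_cast_le N k)
  have h1 : rho c * ((k : ℤ) : ℝ) ≤ rho c * N := mul_le_mul_of_nonneg_left hk.2 hρ.le
  have hpos : 0 < r - rho c * ((k : ℤ) : ℝ) := by linarith
  rw [pVec_eq hc, abs_div, abs_of_pos hρ, abs_of_pos hpos]
  exact div_le_div_of_nonneg_left hρ.le (by linarith) (by linarith)

/-- `|q_r(k)| ≤ ρ/(r − ρN)` for `r > ρN`. [cite: Groskin2026, §3 (p. 8)] -/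
theorem abs_qVec_le (hc : 1 < c) (N : ℕ) (k : idx N) {r : ℝ} (hr : rho c * N < r) :
    |qVec c N r k| ≤ rho c / (r - rho c * N) := by
  have hρ := rho_pos hc
  have hk := abs_le.1 (abs_cast_le N k)
  have h2 : rho c * (-(N : ℝ)) ≤ rho c * ((k : ℤ) : ℝ) := mul_le_mul_of_nonneg_left hk.1 hρ.le
  have hpos : 0 < r + rho c * ((k : ℤ) : ℝ) := by linarith
  rw [qVec_eq hc, abs_div, abs_of_pos hρ, abs_of_pos hpos]
  exact div_le_div_of_nonneg_left hρ.le (by linarith) (by linarith)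

/-- The density `h₊(r) sin²(Lr/2) ρ⁻¹ (p_r(m)p_r(n) + q_r(m)q_r(n))` is continuous on `(T₁, ∞)`,
`T₁ > ρN`. [cite: Groskin2026, §3 (p. 8)] -/
theorem continuousOn_density (hc : 1 < c) (N : ℕ) (m n : idx N) {T₁ : ℝ} (hT₁ : rho c * N < T₁) :
    ContinuousOn (fun r ↦ hPlus r * Real.sin (Real.log c * r / 2) ^ 2 / rho c *
      (pVec c N r m * pVec c N r n + qVec c N r m * qVec c N r n)) (Ioi T₁) := by
  refine continuousOn_of_forall_continuousAt fun r hr ↦ ?_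
  have hr' : T₁ ≤ r := le_of_lt hr
  have h1 : ContinuousAt (fun r ↦ hPlus r * Real.sin (Real.log c * r / 2) ^ 2 / rho c) r :=
    ((continuous_hPlus.continuousAt).mul (by fun_prop)).div_const _
  exact h1.mul (((continuousAt_pVec hc N m hT₁ hr').mul (continuousAt_pVec hc N n hT₁ hr')).add
    ((continuousAt_qVec hc N m hT₁ hr').mul (continuousAt_qVec hc N n hT₁ hr')))

/-- **The density is integrable on `(T₁, ∞)`** for `T₁ > max(ρN, 7)`: it is
`O((1 + √r)/r²)` there (`h₊ = O(√r)`, `|p|, |q| ≤ ρ/(r − ρN)`). [cite: Groskin2026, Corollary 3.3 (p. 11)] -/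
theorem integrableOn_density (hc : 1 < c) (N : ℕ) (m n : idx N) {T₁ : ℝ}
    (hT₁ : max (rho c * N) 7 < T₁) :
    IntegrableOn (fun r ↦ hPlus r * Real.sin (Real.log c * r / 2) ^ 2 / rho c *
      (pVec c N r m * pVec c N r n + qVec c N r m * qVec c N r n)) (Ioi T₁) := by
  have hρ := rho_pos hc
  have hρN : rho c * N < T₁ := lt_of_le_of_lt (le_max_left _ _) hT₁
  have hT₁pos : 0 < T₁ := lt_trans (by norm_num) (lt_of_le_of_lt (le_max_right _ _) hT₁)
  have hρN0 : 0 ≤ rho c * N := by positivity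
  obtain ⟨B, hB, hB'⟩ := exists_abs_hPlus_le
  set A := |hPlus 0| with hA
  -- κ := (T₁ − ρN)/T₁ ∈ (0,1]: r − ρN ≥ κ r on r ≥ T₁
  set κ : ℝ := (T₁ - rho c * N) / T₁ with hκ
  have hκpos : 0 < κ := div_pos (by linarith) hT₁pos
  set C : ℝ := 1 / rho c * (2 * rho c ^ 2) / κ ^ 2 with hC
  have hCpos : 0 < C := by positivity
  -- dominating function
  set g : ℝ → ℝ := fun r ↦ C * A * r ^ (-2 : ℝ) + C * B * r ^ (-(3 / 2) : ℝ) with hg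
  have hgi : IntegrableOn g (Ioi T₁) :=
    ((integrableOn_Ioi_rpow_of_lt (by norm_num) hT₁pos).const_mul (C * A)).add
      ((integrableOn_Ioi_rpow_of_lt (by norm_num) hT₁pos).const_mul (C * B))
  refine Integrable.mono' hgi
    ((continuousOn_density hc N m n hρN).aestronglyMeasurable measurableSet_Ioi) ?_
  refine (ae_restrict_iff' measurableSet_Ioi).2 (Filter.Eventually.of_forall fun r hr ↦ ?_)
  have hr : T₁ < r := hr
  have hrpos : 0 < r := lt_trans hT₁pos hr
  have hρNr : rho c * N < r := lt_trans hρN hr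
  -- r - ρN ≥ κ r
  have hκr : κ * r ≤ r - rho c * N := by
    rw [hκ, div_mul_eq_mul_div, div_le_iff₀ hT₁pos]
    nlinarith
  have hκr_pos : 0 < κ * r := mul_pos hκpos hrpos
  have hp : ∀ k : idx N, |pVec c N r k| ≤ rho c / (κ * r) := fun k ↦
    (abs_pVec_le hc N k hρNr).trans (div_le_div_of_nonneg_left hρ.le hκr_pos hκr)
  have hq : ∀ k : idx N, |qVec c N r k| ≤ rho c / (κ * r) := fun k ↦
    (abs_qVec_le hc N k hρNr).trans (div_le_div_of_nonneg_left hρ.le hκr_pos hκr)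
  have hsin : |Real.sin (Real.log c * r / 2) ^ 2| ≤ 1 := by
    rw [abs_of_nonneg (sq_nonneg _)]
    nlinarith [Real.sin_sq_le_one (Real.log c * r / 2)]
  have hh : |hPlus r| ≤ A + B * Real.sqrt r := by
    have := hB' r; rwa [abs_of_pos hrpos] at this
  have hpq : |pVec c N r m * pVec c N r n + qVec c N r m * qVec c N r n| ≤
      2 * (rho c / (κ * r)) ^ 2 := by
    have h0 : 0 ≤ rho c / (κ * r) := by positivity
    calc |pVec c N r m * pVec c N r n + qVec c N r m * qVec c N r n|
        ≤ |pVec c N r m * pVec c N r n| + |qVec c N r m * qVec c N r n| := abs_add_le _ _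
      _ = |pVec c N r m| * |pVec c N r n| + |qVec c N r m| * |qVec c N r n| := by
          rw [abs_mul, abs_mul]
      _ ≤ rho c / (κ * r) * (rho c / (κ * r)) + rho c / (κ * r) * (rho c / (κ * r)) := by
          gcongr
          · exact hp m
          · exact hp n
          · exact hq m
          · exact hq n
      _ = 2 * (rho c / (κ * r)) ^ 2 := by ring
  -- assemble
  have e2 : r ^ (-2 : ℝ) = (r ^ 2)⁻¹ := by
    rw [Real.rpow_neg hrpos.le, show (2:ℝ) = (2:ℕ) by norm_num, Real.rpow_natCast]
  have e3 : r ^ (-(3 / 2) : ℝ) = Real.sqrt r * (r ^ 2)⁻¹ := by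
    rw [Real.sqrt_eq_rpow, ← e2, ← Real.rpow_add hrpos]
    norm_num
  have hA0 : 0 ≤ A := abs_nonneg _
  have hAB0 : 0 ≤ A + B * Real.sqrt r := add_nonneg hA0 (mul_nonneg hB (Real.sqrt_nonneg _))
  have step1 : |hPlus r| * |Real.sin (Real.log c * r / 2) ^ 2| ≤ (A + B * Real.sqrt r) * 1 :=
    mul_le_mul hh hsin (abs_nonneg _) hAB0
  have step2 : |hPlus r| * |Real.sin (Real.log c * r / 2) ^ 2| / rho c ≤
      (A + B * Real.sqrt r) * 1 / rho c := div_le_div_of_nonneg_right step1 hρ.le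
  have step3 := mul_le_mul step2 hpq (abs_nonneg _)
    (div_nonneg (mul_nonneg hAB0 zero_le_one) hρ.le)
  rw [hg]
  simp only
  rw [e2, e3, Real.norm_eq_abs, abs_mul, abs_div, abs_mul, abs_of_pos hρ]
  calc |hPlus r| * |Real.sin (Real.log c * r / 2) ^ 2| / rho c *
        |pVec c N r m * pVec c N r n + qVec c N r m * qVec c N r n|
      ≤ (A + B * Real.sqrt r) * 1 / rho c * (2 * (rho c / (κ * r)) ^ 2) := step3
    _ = C * A * (r ^ 2)⁻¹ + C * B * (Real.sqrt r * (r ^ 2)⁻¹) := by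
        rw [hC]; ring

end Limit

/-! ## §2 The limit `T → ∞`: Lemma 2.1 (first clause); `Q_∞ − Q_T` as a tail integral -/

section Tail

variable {c : ℝ}

/-- `Q_arch,T'(m,n) → Q_arch,T(m,n) + (1/π²)∫_T^∞ (density)` as `T' → ∞`, for `T > max(ρN,7)`.
[cite: Groskin2026, Lemma 2.1 (p. 4) and Corollary 3.3 (p. 11)] -/
theorem tendsto_archMatrix_apply (hc : 1 < c) (N : ℕ) {T : ℝ} (hT : max (rho c * N) 7 < T)
    (m n : idx N) :
    Tendsto (fun T' : ℝ ↦ archMatrix c N T' m n) atTop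
      (𝓝 (archMatrix c N T m n + (1 / π ^ 2) * ∫ r in Ioi T,
        hPlus r * Real.sin (Real.log c * r / 2) ^ 2 / rho c *
          (pVec c N r m * pVec c N r n + qVec c N r m * qVec c N r n))) := by
  have hint := integrableOn_density hc N m n hT
  have hb : Tendsto (fun T' : ℝ ↦ T') atTop atTop := tendsto_id
  have hlim := ((intervalIntegral_tendsto_integral_Ioi T hint hb).const_mul
    (1 / π ^ 2)).const_add (archMatrix c N T m n)
  refine hlim.congr' ?_
  filter_upwards [eventually_gt_atTop T] with T' hT'
  have h := archMatrix_sub_apply_eq hc N hT hT' m n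
  rw [Matrix.sub_apply] at h
  linarith

/-- **Groskin 2026, Lemma 2.1, first clause — DISCHARGED**: the limit defining `Q_arch,∞` exists
entrywise. [claim: Groskin2026, status: under-review] [cite: Groskin2026, Lemma 2.1 (p. 4)] -/
theorem lemma_2_1_limit_holds' : lemma_2_1_limit := by
  intro c hc N m n
  have hT : max (rho c * N) 7 < max (rho c * N) 7 + 1 := lt_add_one _
  have h := tendsto_archMatrix_apply hc N hT m n
  have e : archMatrixInfty c N m n = limUnder atTop (fun T : ℝ ↦ archMatrix c N T m n) := rfl
  rw [e]
  exact tendsto_nhds_limUnder ⟨_, h⟩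

/-- **`(Q_arch,∞ − Q_arch,T)(m,n) = (1/π²)∫_T^∞ h₊ sin²(Lr/2) ρ⁻¹ (p p + q q)`** for `T > max(ρN,7)`.
[cite: Groskin2026, Corollary 3.3 proof (p. 11)] -/
theorem archMatrixInfty_sub_apply (hc : 1 < c) (N : ℕ) {T : ℝ} (hT : max (rho c * N) 7 < T)
    (m n : idx N) :
    archMatrixInfty c N m n - archMatrix c N T m n = (1 / π ^ 2) * ∫ r in Ioi T,
      hPlus r * Real.sin (Real.log c * r / 2) ^ 2 / rho c *
        (pVec c N r m * pVec c N r n + qVec c N r m * qVec c N r n) := by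
  have h1 : Tendsto (fun T' : ℝ ↦ archMatrix c N T' m n) atTop (𝓝 (archMatrixInfty c N m n)) :=
    lemma_2_1_limit_holds' c hc N m n
  have h2 := tendsto_archMatrix_apply hc N hT m n
  have := tendsto_nhds_unique h1 h2
  linarith

end Tail

/-! ## §3 Positive definiteness and Corollary 3.3 (i) -/

section Corollary

variable {c : ℝ}

/-- The divided-difference matrix is symmetric. [cite: Groskin2026, §2.1 (p. 3)] -/
theorem dividedDiffMatrix_symm (ψ : ℝ → ℝ) (N : ℕ) (m n : idx N) :
    dividedDiffMatrix ψ N m n = dividedDiffMatrix ψ N n m := by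
  simp only [dividedDiffMatrix, Matrix.of_apply]
  split_ifs with h1 h2 h2
  · rw [h1]
  · exact absurd h1.symm h2
  · exact absurd h2.symm h1
  · rw [show ψ ((m : ℤ) : ℝ) - ψ ((n : ℤ) : ℝ) = -(ψ ((n : ℤ) : ℝ) - ψ ((m : ℤ) : ℝ)) by ring,
      show ((m : ℤ) : ℝ) - ((n : ℤ) : ℝ) = -(((n : ℤ) : ℝ) - ((m : ℤ) : ℝ)) by ring, neg_div_neg_eq]

/-- `Q_arch,T` is symmetric. [cite: Groskin2026, §2.1 (p. 4)] -/
theorem archMatrix_symm (c : ℝ) (N : ℕ) (T : ℝ) (m n : idx N) :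
    archMatrix c N T m n = archMatrix c N T n m :=
  dividedDiffMatrix_symm _ N m n

/-- `Q_arch,∞` is symmetric. [cite: Groskin2026, §2.1 (p. 4)] -/
theorem archMatrixInfty_symm (c : ℝ) (N : ℕ) (m n : idx N) :
    archMatrixInfty c N m n = archMatrixInfty c N n m := by
  show limUnder atTop (fun T : ℝ ↦ archMatrix c N T m n) =
    limUnder atTop (fun T : ℝ ↦ archMatrix c N T n m)
  congr 1
  funext T
  exact archMatrix_symm c N T m n

/-- A rank-two quadratic form: `Σ_{i,j} x_i x_j w (p_i p_j + q_i q_j) = w((x·p)² + (x·q)²)`. [folklore] -/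
private theorem sum_sum_rankTwo {ι : Type*} [Fintype ι] (x p q : ι → ℝ) (w : ℝ) :
    ∑ i, ∑ j, x i * x j * (w * (p i * p j + q i * q j)) =
      w * ((x ⬝ᵥ p) ^ 2 + (x ⬝ᵥ q) ^ 2) := by
  have h1 : (x ⬝ᵥ p) ^ 2 = ∑ i, ∑ j, x i * p i * (x j * p j) := by
    rw [dotProduct, sq, Finset.sum_mul_sum]
  have h2 : (x ⬝ᵥ q) ^ 2 = ∑ i, ∑ j, x i * q i * (x j * q j) := by
    rw [dotProduct, sq, Finset.sum_mul_sum]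
  rw [h1, h2, ← Finset.sum_add_distrib, Finset.mul_sum]
  refine Finset.sum_congr rfl fun i _ ↦ ?_
  rw [← Finset.sum_add_distrib, Finset.mul_sum]
  refine Finset.sum_congr rfl fun j _ ↦ ?_
  ring

/-- Cauchy–Schwarz for the rank-two form: `(x·p)² + (x·q)² ≤ (x·x)(p·p + q·q)`. [folklore] -/
private theorem rankTwo_le {ι : Type*} [Fintype ι] (x p q : ι → ℝ) :
    (x ⬝ᵥ p) ^ 2 + (x ⬝ᵥ q) ^ 2 ≤ (x ⬝ᵥ x) * (p ⬝ᵥ p + q ⬝ᵥ q) := by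
  have hp := Finset.sum_mul_sq_le_sq_mul_sq Finset.univ x p
  have hq := Finset.sum_mul_sq_le_sq_mul_sq Finset.univ x q
  simp only [dotProduct]
  simp only [← sq] at hp hq ⊢
  nlinarith

/-- The partial-fraction polynomial `P_x(a) = Σ_k x_k Π_{j ≠ k}(a − j)`: for `a` off the nodes,
`(Π_j (a − j)) · Σ_k x_k/(a − k) = P_x(a)`. [folklore] -/
private theorem prod_mul_sum_div_eq_eval (N : ℕ) (x : idx N → ℝ) {a : ℝ}
    (ha : ∀ j : idx N, a - ((j : ℤ) : ℝ) ≠ 0) :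
    (∏ j : idx N, (a - ((j : ℤ) : ℝ))) * ∑ k : idx N, x k * (1 / (a - ((k : ℤ) : ℝ))) =
      Polynomial.eval a (∑ k : idx N, Polynomial.C (x k) *
        ∏ j ∈ Finset.univ.erase k, (Polynomial.X - Polynomial.C (((j : ℤ) : ℝ)))) := by
  classical
  rw [Polynomial.eval_finsetSum, Finset.mul_sum]
  refine Finset.sum_congr rfl fun k _ ↦ ?_
  rw [Polynomial.eval_mul, Polynomial.eval_C, Polynomial.eval_prod]
  simp only [Polynomial.eval_sub, Polynomial.eval_X, Polynomial.eval_C]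
  rw [← Finset.mul_prod_erase Finset.univ (fun j : idx N ↦ a - ((j : ℤ) : ℝ)) (Finset.mem_univ k)]
  field_simp [ha k]

/-- `P_x ≠ 0` for `x ≠ 0` (evaluate at a node `k₀` with `x_{k₀} ≠ 0`). [folklore] -/
private theorem partialFraction_poly_ne_zero (N : ℕ) {x : idx N → ℝ} (hx : x ≠ 0) :
    (∑ k : idx N, Polynomial.C (x k) *
        ∏ j ∈ Finset.univ.erase k, (Polynomial.X - Polynomial.C (((j : ℤ) : ℝ)))) ≠ 0 := by
  classical
  obtain ⟨k₀, hk₀⟩ := Function.ne_iff.1 hx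
  intro hP
  have h := congrArg (Polynomial.eval (((k₀ : ℤ) : ℝ))) hP
  rw [Polynomial.eval_finsetSum, Polynomial.eval_zero,
    Finset.sum_eq_single k₀ (fun k _ hk ↦ ?_) (fun h ↦ absurd (Finset.mem_univ _) h)] at h
  · rw [Polynomial.eval_mul, Polynomial.eval_C, Polynomial.eval_prod] at h
    simp only [Polynomial.eval_sub, Polynomial.eval_X, Polynomial.eval_C] at h
    rcases mul_eq_zero.1 h with h0 | h0
    · exact hk₀ h0
    · rw [Finset.prod_eq_zero_iff] at h0
      obtain ⟨j, hj, hj0⟩ := h0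
      have hne : j ≠ k₀ := Finset.ne_of_mem_erase hj
      apply hne
      apply Subtype.ext
      have : ((k₀ : ℤ) : ℝ) = ((j : ℤ) : ℝ) := by linarith
      exact_mod_cast this.symm
  · rw [Polynomial.eval_mul, Polynomial.eval_prod]
    apply mul_eq_zero_of_right
    have hmem : k₀ ∈ Finset.univ.erase k := Finset.mem_erase.2 ⟨fun h ↦ hk h.symm, Finset.mem_univ k₀⟩
    exact Finset.prod_eq_zero hmem (by simp)

/-- **`x·p_r ≠ 0` off a finite set**: for `x ≠ 0` there is a finite set `Z ⊂ ℝ` with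
`x·p_r = 0, r > ρN ⇒ r/ρ ∈ Z`. [folklore] -/
private theorem dotProduct_pVec_eq_zero_finite (hc : 1 < c) (N : ℕ) {x : idx N → ℝ} (hx : x ≠ 0) :
    ∃ Z : Set ℝ, Z.Finite ∧ ∀ r : ℝ, rho c * N < r → x ⬝ᵥ pVec c N r = 0 → r / rho c ∈ Z := by
  classical
  set P := ∑ k : idx N, Polynomial.C (x k) *
    ∏ j ∈ Finset.univ.erase k, (Polynomial.X - Polynomial.C (((j : ℤ) : ℝ))) with hPdef
  have hP : P ≠ 0 := partialFraction_poly_ne_zero N hx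
  refine ⟨{a | P.IsRoot a}, Polynomial.finite_setOf_isRoot hP, fun r hr h0 ↦ ?_⟩
  have hρ := rho_pos hc
  set a := r / rho c with ha
  have hnode : ∀ j : idx N, a - ((j : ℤ) : ℝ) ≠ 0 := by
    intro j
    have hj := (abs_le.1 (abs_cast_le N j)).2
    have : (N : ℝ) < a := by rw [ha, lt_div_iff₀ hρ]; linarith
    exact (by linarith : 0 < a - ((j : ℤ) : ℝ)).ne'
  have hx0 : ∑ k : idx N, x k * (1 / (a - ((k : ℤ) : ℝ))) = 0 := by
    have : x ⬝ᵥ pVec c N r = ∑ k : idx N, x k * (1 / (a - ((k : ℤ) : ℝ))) := by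
      simp only [dotProduct, pVec, aCut, ha]
    rw [← this, h0]
  have key := prod_mul_sum_div_eq_eval N x hnode
  rw [hx0, mul_zero] at key
  exact key.symm

/-- The zeros of `sin(Lr/2)` in a bounded interval are finite (`r ∈ ρℤ`). [folklore] -/
private theorem finite_sin_zeros (hc : 1 < c) (T : ℝ) :
    {r : ℝ | r ∈ Ioo T (T + 1) ∧ Real.sin (Real.log c * r / 2) = 0}.Finite := by
  have hρ := rho_pos hc
  have hL := Real.log_pos hc
  refine ((Set.finite_Icc ⌊T / rho c⌋ ⌈(T + 1) / rho c⌉).image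
    (fun k : ℤ ↦ (k : ℝ) * rho c)).subset ?_
  rintro r ⟨hr, hs⟩
  obtain ⟨k, hk⟩ := Real.sin_eq_zero_iff.1 hs
  have hrk : r = (k : ℝ) * rho c := by
    unfold rho
    field_simp
    linarith
  refine ⟨k, ⟨?_, ?_⟩, hrk.symm⟩
  · have h1 : T / rho c < k := by rw [div_lt_iff₀ hρ]; linarith [hr.1]
    have h2 : (⌊T / rho c⌋ : ℝ) ≤ T / rho c := Int.floor_le _
    exact_mod_cast (by linarith : (⌊T / rho c⌋ : ℝ) < k).le
  · have h1 : (k : ℝ) < (T + 1) / rho c := by rw [lt_div_iff₀ hρ]; linarith [hr.2]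
    have h2 : (T + 1) / rho c ≤ (⌈(T + 1) / rho c⌉ : ℝ) := Int.le_ceil _
    exact_mod_cast (by linarith : (k : ℝ) < ⌈(T + 1) / rho c⌉).le

/-- **A point of strict positivity of the density**: for `x ≠ 0` and `T > max(ρN,7)` there is
`r₀ ∈ (T, T+1)` with `sin(Lr₀/2) ≠ 0` and `x·p_{r₀} ≠ 0`. [folklore] -/
private theorem exists_good_point (hc : 1 < c) (N : ℕ) {T : ℝ} (hT : max (rho c * N) 7 < T) {x : idx N → ℝ}
    (hx : x ≠ 0) :
    ∃ r₀ : ℝ, T < r₀ ∧ r₀ < T + 1 ∧ Real.sin (Real.log c * r₀ / 2) ≠ 0 ∧ x ⬝ᵥ pVec c N r₀ ≠ 0 := by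
  have hρ := rho_pos hc
  have hρN : rho c * N < T := lt_of_le_of_lt (le_max_left _ _) hT
  obtain ⟨Z, hZ, hZ'⟩ := dotProduct_pVec_eq_zero_finite hc N hx
  set Bad : Set ℝ := {r : ℝ | r ∈ Ioo T (T + 1) ∧ Real.sin (Real.log c * r / 2) = 0} ∪
    (fun a ↦ rho c * a) '' Z with hBad
  have hfin : Bad.Finite := (finite_sin_zeros hc T).union (hZ.image _)
  obtain ⟨r₀, hr₀, hnot⟩ := ((Set.Ioo_infinite (lt_add_one T)).sdiff hfin).nonempty
  refine ⟨r₀, hr₀.1, hr₀.2, fun hs ↦ hnot (Or.inl ⟨hr₀, hs⟩), fun h0 ↦ hnot (Or.inr ?_)⟩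
  refine ⟨r₀ / rho c, hZ' r₀ (lt_trans hρN hr₀.1) h0, ?_⟩
  field_simp

/-- The quadratic form of `Q_∞ − Q_T` as a tail integral of the rank-two density.
[cite: Groskin2026, Corollary 3.3 proof (p. 11)] -/
theorem quadForm_eq_integral (hc : 1 < c) (N : ℕ) {T : ℝ} (hT : max (rho c * N) 7 < T)
    (x : idx N → ℝ) :
    x ⬝ᵥ ((archMatrixInfty c N - archMatrix c N T) *ᵥ x) = (1 / π ^ 2) * ∫ r in Ioi T,
      hPlus r * Real.sin (Real.log c * r / 2) ^ 2 / rho c *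
        ((x ⬝ᵥ pVec c N r) ^ 2 + (x ⬝ᵥ qVec c N r) ^ 2) := by
  have hint : ∀ i j : idx N, Integrable (fun r ↦ x i * x j * (hPlus r *
      Real.sin (Real.log c * r / 2) ^ 2 / rho c *
        (pVec c N r i * pVec c N r j + qVec c N r i * qVec c N r j))) (volume.restrict (Ioi T)) :=
    fun i j ↦ (integrableOn_density hc N i j hT).const_mul _
  simp_rw [← sum_sum_rankTwo x]
  rw [MeasureTheory.integral_finsetSum _
    (fun i _ ↦ MeasureTheory.integrable_finsetSum _ (fun j _ ↦ hint i j)), Finset.mul_sum]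
  simp only [dotProduct, Matrix.mulVec]
  refine Finset.sum_congr rfl fun i _ ↦ ?_
  rw [MeasureTheory.integral_finsetSum _ (fun j _ ↦ hint i j), Finset.mul_sum, Finset.mul_sum]
  refine Finset.sum_congr rfl fun j _ ↦ ?_
  rw [MeasureTheory.integral_const_mul, Matrix.sub_apply, archMatrixInfty_sub_apply hc N hT]
  ring

/-- The rank-two density against `x` is integrable on `(T, ∞)`. [cite: Groskin2026, Corollary 3.3 (p. 11)] -/
theorem integrableOn_quadDensity (hc : 1 < c) (N : ℕ) {T : ℝ} (hT : max (rho c * N) 7 < T)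
    (x : idx N → ℝ) :
    IntegrableOn (fun r ↦ hPlus r * Real.sin (Real.log c * r / 2) ^ 2 / rho c *
        ((x ⬝ᵥ pVec c N r) ^ 2 + (x ⬝ᵥ qVec c N r) ^ 2)) (Ioi T) := by
  have hint : ∀ i j : idx N, Integrable (fun r ↦ x i * x j * (hPlus r *
      Real.sin (Real.log c * r / 2) ^ 2 / rho c *
        (pVec c N r i * pVec c N r j + qVec c N r i * qVec c N r j))) (volume.restrict (Ioi T)) :=
    fun i j ↦ (integrableOn_density hc N i j hT).const_mul _
  have h := MeasureTheory.integrable_finsetSum Finset.univ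
    (fun i _ ↦ MeasureTheory.integrable_finsetSum Finset.univ (fun j _ ↦ hint i j))
  refine h.congr (Filter.Eventually.of_forall fun r ↦ ?_)
  exact sum_sum_rankTwo x _ _ _

/-- The trace density `h₊ sin² ρ⁻¹ (p·p + q·q)` is integrable on `(T, ∞)`. [cite: Groskin2026, Corollary 3.3 (p. 11)] -/
theorem integrableOn_traceDensity (hc : 1 < c) (N : ℕ) {T : ℝ} (hT : max (rho c * N) 7 < T) :
    IntegrableOn (fun r ↦ hPlus r * Real.sin (Real.log c * r / 2) ^ 2 / rho c *
        (pVec c N r ⬝ᵥ pVec c N r + qVec c N r ⬝ᵥ qVec c N r)) (Ioi T) := by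
  have h := MeasureTheory.integrable_finsetSum Finset.univ
    (fun i _ ↦ (integrableOn_density hc N i i hT : Integrable _ (volume.restrict (Ioi T))))
  refine h.congr (Filter.Eventually.of_forall fun r ↦ ?_)
  simp only [dotProduct, ← Finset.mul_sum, ← Finset.sum_add_distrib]

/-- **Groskin 2026, Corollary 3.3 (i) — DISCHARGED** (Loewner form): for `T > max(ρN,7)`,
`Q_∞ − Q_T^tot ≻ 0` and `Q_∞ − Q_T^tot ⪯ B_T·I`. Road: Thm 3.2 clause 1 + Lemma 2.1 give
`xᵗ(Q_∞ − Q_T^tot)x = (1/π²)∫_T^∞ h₊ sin²(Lr/2)ρ⁻¹((x·p_r)² + (x·q_r)²) dr`; strictness because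
`x·p_r` is a non-zero rational function of `r` and `h₊ > 0` on `[7,∞)`; the bound by Cauchy–Schwarz.
[claim: Groskin2026, status: under-review] [cite: Groskin2026, Corollary 3.3 (p. 11)] -/
theorem corollary_3_3_i_holds' : corollary_3_3_i := by
  intro c hc N T hT
  classical
  have hρ := rho_pos hc
  have hρN : rho c * N < T := lt_of_le_of_lt (le_max_left _ _) hT
  have h7 : (7 : ℝ) < T := lt_of_le_of_lt (le_max_right _ _) hT
  -- the difference is the archimedean tail
  have hM : cutoffFreeMatrix c N - totalMatrix c N T = archMatrixInfty c N - archMatrix c N T := by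
    simp only [cutoffFreeMatrix, totalMatrix]; abel
  -- symmetry
  have hsymm : (archMatrixInfty c N - archMatrix c N T).IsHermitian := by
    refine Matrix.IsHermitian.ext fun i j ↦ ?_
    rw [star_trivial, Matrix.sub_apply, Matrix.sub_apply, archMatrixInfty_symm c N j i,
      archMatrix_symm c N T j i]
  -- nonnegativity of the weight
  have hw : ∀ r, T < r → 0 ≤ hPlus r * Real.sin (Real.log c * r / 2) ^ 2 / rho c := fun r hr ↦
    div_nonneg (mul_nonneg (hPlus_pos_of_seven_le (by linarith)).le (sq_nonneg _)) hρ.le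
  rw [hM]
  constructor
  · -- positive definite
    refine Matrix.PosDef.of_dotProduct_mulVec_pos hsymm fun x hx ↦ ?_
    rw [star_trivial, quadForm_eq_integral hc N hT x]
    refine mul_pos (by positivity) ?_
    set g : ℝ → ℝ := fun r ↦ hPlus r * Real.sin (Real.log c * r / 2) ^ 2 / rho c *
        ((x ⬝ᵥ pVec c N r) ^ 2 + (x ⬝ᵥ qVec c N r) ^ 2) with hgdef
    have hgi : IntegrableOn g (Ioi T) := integrableOn_quadDensity hc N hT x
    have hg0 : 0 ≤ᵐ[volume.restrict (Ioi T)] g :=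
      (ae_restrict_iff' measurableSet_Ioi).2 (Filter.Eventually.of_forall fun r hr ↦
        mul_nonneg (hw r hr) (by positivity))
    rw [setIntegral_pos_iff_support_of_nonneg_ae hg0 hgi]
    -- a point of strict positivity and continuity there
    obtain ⟨r₀, hr₀T, hr₀T1, hsin, hxp⟩ := exists_good_point hc N hT hx
    have hg_pos : 0 < g r₀ := by
      have h1 : 0 < hPlus r₀ * Real.sin (Real.log c * r₀ / 2) ^ 2 / rho c :=
        div_pos (mul_pos (hPlus_pos_of_seven_le (by linarith)) (by positivity)) hρ
      have h2 : 0 < (x ⬝ᵥ pVec c N r₀) ^ 2 + (x ⬝ᵥ qVec c N r₀) ^ 2 := by positivity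
      exact mul_pos h1 h2
    have hg_cont : ContinuousAt g r₀ := by
      have hr₀' : T ≤ r₀ := hr₀T.le
      have hp : ∀ k, ContinuousAt (fun r ↦ pVec c N r k) r₀ :=
        fun k ↦ continuousAt_pVec hc N k hρN hr₀'
      have hq : ∀ k, ContinuousAt (fun r ↦ qVec c N r k) r₀ :=
        fun k ↦ continuousAt_qVec hc N k hρN hr₀'
      have hdp : ContinuousAt (fun r ↦ x ⬝ᵥ pVec c N r) r₀ := by
        have : (fun r ↦ x ⬝ᵥ pVec c N r) = fun r ↦ ∑ k, x k * pVec c N r k := by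
          funext r; rfl
        rw [this]
        exact tendsto_finsetSum _ fun k _ ↦ (hp k).const_mul (x k)
      have hdq : ContinuousAt (fun r ↦ x ⬝ᵥ qVec c N r) r₀ := by
        have : (fun r ↦ x ⬝ᵥ qVec c N r) = fun r ↦ ∑ k, x k * qVec c N r k := by
          funext r; rfl
        rw [this]
        exact tendsto_finsetSum _ fun k _ ↦ (hq k).const_mul (x k)
      have h1 : ContinuousAt (fun r ↦ hPlus r * Real.sin (Real.log c * r / 2) ^ 2 / rho c) r₀ :=
        ((continuous_hPlus.continuousAt).mul (by fun_prop)).div_const _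
      exact h1.mul ((hdp.pow 2).add (hdq.pow 2))
    -- an open ball inside the support
    have hev : ∀ᶠ r in 𝓝 r₀, 0 < g r := hg_cont.eventually (lt_mem_nhds hg_pos)
    obtain ⟨ε, hε, hball⟩ := Metric.eventually_nhds_iff.1 hev
    set δ := min ε (r₀ - T) with hδ
    have hδpos : 0 < δ := lt_min hε (by linarith)
    have hsub : Metric.ball r₀ δ ⊆ Function.support g ∩ Ioi T := by
      intro r hr
      rw [Metric.mem_ball] at hr
      refine ⟨(hball (lt_of_lt_of_le hr (min_le_left _ _))).ne', ?_⟩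
      have : dist r r₀ < r₀ - T := lt_of_lt_of_le hr (min_le_right _ _)
      rw [Real.dist_eq] at this
      show T < r
      linarith [neg_abs_le (r - r₀)]
    calc (0 : ENNReal) < volume (Metric.ball r₀ δ) := by
          rw [Real.volume_ball]; exact ENNReal.ofReal_pos.2 (by linarith)
      _ ≤ volume (Function.support g ∩ Ioi T) := measure_mono hsub
  · -- the Loewner bound by the trace
    have hB : (tailBudget c N T • (1 : Matrix (idx N) (idx N) ℝ)).IsHermitian := by
      rw [Matrix.IsHermitian, Matrix.conjTranspose_smul, Matrix.conjTranspose_one, star_trivial]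
    refine Matrix.PosSemidef.of_dotProduct_mulVec_nonneg (hB.sub hsymm) fun x ↦ ?_
    rw [star_trivial, Matrix.sub_mulVec, dotProduct_sub, Matrix.smul_mulVec, Matrix.one_mulVec,
      dotProduct_smul, smul_eq_mul, quadForm_eq_integral hc N hT x, sub_nonneg]
    have hI : (∫ r in Ioi T, hPlus r * Real.sin (Real.log c * r / 2) ^ 2 / rho c *
        ((x ⬝ᵥ pVec c N r) ^ 2 + (x ⬝ᵥ qVec c N r) ^ 2)) ≤
        (x ⬝ᵥ x) * ∫ r in Ioi T, hPlus r * Real.sin (Real.log c * r / 2) ^ 2 / rho c *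
          (pVec c N r ⬝ᵥ pVec c N r + qVec c N r ⬝ᵥ qVec c N r) := by
      rw [← MeasureTheory.integral_const_mul]
      refine integral_mono_ae (integrableOn_quadDensity hc N hT x)
        ((integrableOn_traceDensity hc N hT).const_mul _) ?_
      refine (ae_restrict_iff' measurableSet_Ioi).2 (Filter.Eventually.of_forall fun r hr ↦ ?_)
      have hcs := rankTwo_le x (pVec c N r) (qVec c N r)
      have hw' := hw r hr
      calc hPlus r * Real.sin (Real.log c * r / 2) ^ 2 / rho c *
            ((x ⬝ᵥ pVec c N r) ^ 2 + (x ⬝ᵥ qVec c N r) ^ 2)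
          ≤ hPlus r * Real.sin (Real.log c * r / 2) ^ 2 / rho c *
            ((x ⬝ᵥ x) * (pVec c N r ⬝ᵥ pVec c N r + qVec c N r ⬝ᵥ qVec c N r)) :=
            mul_le_mul_of_nonneg_left hcs hw'
        _ = (x ⬝ᵥ x) * (hPlus r * Real.sin (Real.log c * r / 2) ^ 2 / rho c *
            (pVec c N r ⬝ᵥ pVec c N r + qVec c N r ⬝ᵥ qVec c N r)) := by ring
    unfold tailBudget
    calc 1 / π ^ 2 * ∫ r in Ioi T, hPlus r * Real.sin (Real.log c * r / 2) ^ 2 / rho c *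
          ((x ⬝ᵥ pVec c N r) ^ 2 + (x ⬝ᵥ qVec c N r) ^ 2)
        ≤ 1 / π ^ 2 * ((x ⬝ᵥ x) * ∫ r in Ioi T, hPlus r * Real.sin (Real.log c * r / 2) ^ 2 / rho c *
          (pVec c N r ⬝ᵥ pVec c N r + qVec c N r ⬝ᵥ qVec c N r)) :=
          mul_le_mul_of_nonneg_left hI (by positivity)
      _ = 1 / π ^ 2 * (∫ r in Set.Ioi T, hPlus r * Real.sin (Real.log c * r / 2) ^ 2 / rho c *
          (pVec c N r ⬝ᵥ pVec c N r + qVec c N r ⬝ᵥ qVec c N r)) * (x ⬝ᵥ x) := by ring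

end Corollary

end ArchTail

/-- **Groskin 2026, Lemma 2.1 (first clause) — DISCHARGED.**
[claim: Groskin2026, status: under-review] [cite: Groskin2026, Lemma 2.1 (p. 4)] -/
theorem lemma_2_1_limit_holds : lemma_2_1_limit := ArchTail.lemma_2_1_limit_holds'

/-- **Groskin 2026, Corollary 3.3 (i) — DISCHARGED** (Loewner form as typed).
[claim: Groskin2026, status: under-review] [cite: Groskin2026, Corollary 3.3 (p. 11)] -/
theorem corollary_3_3_i_holds : corollary_3_3_i := ArchTail.corollary_3_3_i_holds'

end Groskin2026

end Literature.NumberTheory.LFunctions
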